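import Summits.AtomisticToContinuum.FouriersLaw.Theorems.ParityLiouvilleSeedWindowLimitGenerator

/-!
# Weak stationarity on polynomially bounded observables, any real parameters (helper for `WindowLimit`)

Helper file for the route item `ParityLiouvilleSeed.WindowLimit` (`stmt-AtomisticToContinuum-13982`).
A weak steady state `μ` of the `N`-chain satisfies `∫ L g dμ = 0` only for `g ∈ C_c^∞`
(`OscillatorChain.IsSteadyState`); the stationarity transfer to bulk windows needs it for smooth
observables `w` of polynomial growth which do not touch the bath momenta (functions of a bulk window).
This file proves the extension ONCE and sign-free:

* `norm_pow_le_sum_abs_pow`, `integrable_one_add_norm_pow` — `(1 + ‖x‖)^K ∈ L¹(μ)` from the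
  per-site moments `|q_i|^K, |p_i|^K ∈ L¹(μ)` (the shape of the item's moment hypothesis);
* `pinnedChain_abs_partialQ_hamiltonian_le` — `|∂_{q_i}H| ≤ (|ω₂| + |lam| + 4 + 16|β|)(1 + ‖x‖)³` for the
  pinned chain with ARBITRARY real parameters;
* `integral_generator_eq_zero_of_polyGrowth` — if `μ` is finite, kills `L g` for `g ∈ C_c^∞`, integrates
  every `(1 + ‖x‖)^K`, the forces are polynomially bounded, and `w ∈ C^∞` has `∂_{p_0}w = ∂_{p_{N-1}}w = 0`
  with `|w|, |Lw| ≤ C(1 + ‖x‖)^K`, then `∫ L w dμ = 0`: test on `w χ(H₀/(n+1))` (reference cut-off of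
  `…WindowLimitGenerator`), `L(wχ_n) = w Lχ_n + χ_n Lw` (no carré-du-champ term), uniform polynomial
  domination, dominated convergence.

Nothing here closes an item.
-/

noncomputable section

namespace Summit.AtomisticToContinuum.FouriersLaw.Theorems.WindowLimit

open MeasureTheory Filter Topology Set
open scoped ContDiff
open Literature.MathematicalPhysics.KineticTheory
open Literature.MathematicalPhysics.KineticTheory.HeatConduction
open Summit.AtomisticToContinuum.FouriersLaw.Theorems.SubdiffusiveBondHeat
open Summit.AtomisticToContinuum.FouriersLaw.Theorems.LinearResponseFTUR

variable {N : ℕ}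

/-! ### Polynomial weights `(1 + ‖x‖)^K` and per-site moments -/

/-- `|q_i| ≤ ‖x‖` and `|p_i| ≤ ‖x‖` (sup norm of phase space). [folklore] -/
theorem abs_coord_le_norm (x : PhaseSpace N) (i : Fin N) : |x.1 i| ≤ ‖x‖ ∧ |x.2 i| ≤ ‖x‖ :=
  ⟨(Real.norm_eq_abs _ ▸ norm_le_pi_norm x.1 i).trans (norm_fst_le x),
    (Real.norm_eq_abs _ ▸ norm_le_pi_norm x.2 i).trans (norm_snd_le x)⟩

/-- `‖x‖^K ≤ ∑_i (|q_i|^K + |p_i|^K)` for a non-empty chain. [folklore] -/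
theorem norm_pow_le_sum_abs_pow (hN : 0 < N) (x : PhaseSpace N) (K : ℕ) :
    ‖x‖ ^ K ≤ ∑ i : Fin N, (|x.1 i| ^ K + |x.2 i| ^ K) := by
  haveI : Nonempty (Fin N) := ⟨⟨0, hN⟩⟩
  obtain ⟨i₁, -, hi₁⟩ := Finset.exists_max_image Finset.univ (fun i : Fin N => |x.1 i|) Finset.univ_nonempty
  obtain ⟨i₂, -, hi₂⟩ := Finset.exists_max_image Finset.univ (fun i : Fin N => |x.2 i|) Finset.univ_nonempty
  have h1 : ‖x.1‖ ≤ |x.1 i₁| :=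
    (pi_norm_le_iff_of_nonneg (abs_nonneg _)).2 fun i => by rw [Real.norm_eq_abs]; exact hi₁ i (Finset.mem_univ _)
  have h2 : ‖x.2‖ ≤ |x.2 i₂| :=
    (pi_norm_le_iff_of_nonneg (abs_nonneg _)).2 fun i => by rw [Real.norm_eq_abs]; exact hi₂ i (Finset.mem_univ _)
  have hs1 : |x.1 i₁| ^ K ≤ ∑ i : Fin N, (|x.1 i| ^ K + |x.2 i| ^ K) :=
    le_trans (by simp) (Finset.single_le_sum (f := fun i : Fin N => |x.1 i| ^ K + |x.2 i| ^ K)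
      (fun i _ => by positivity) (Finset.mem_univ i₁))
  have hs2 : |x.2 i₂| ^ K ≤ ∑ i : Fin N, (|x.1 i| ^ K + |x.2 i| ^ K) :=
    le_trans (by simp [le_add_iff_nonneg_left]) (Finset.single_le_sum
      (f := fun i : Fin N => |x.1 i| ^ K + |x.2 i| ^ K) (fun i _ => by positivity) (Finset.mem_univ i₂))
  rw [Prod.norm_def]
  rcases le_total ‖x.1‖ ‖x.2‖ with h | h
  · rw [max_eq_right h]
    exact (pow_le_pow_left₀ (norm_nonneg _) h2 K).trans hs2
  · rw [max_eq_left h]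
    exact (pow_le_pow_left₀ (norm_nonneg _) h1 K).trans hs1

/-- `(1 + t)^K ≤ 2^K (1 + t^K)` for `t ≥ 0`. [folklore] -/
theorem one_add_pow_le_two_pow_mul {t : ℝ} (ht : 0 ≤ t) (K : ℕ) : (1 + t) ^ K ≤ 2 ^ K * (1 + t ^ K) := by
  rcases le_total t 1 with h | h
  · calc (1 + t) ^ K ≤ (1 + 1) ^ K := pow_le_pow_left₀ (by positivity) (by linarith) K
      _ = 2 ^ K * 1 := by norm_num
      _ ≤ 2 ^ K * (1 + t ^ K) := mul_le_mul_of_nonneg_left (le_add_of_nonneg_right (pow_nonneg ht K)) (by positivity)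
  · calc (1 + t) ^ K ≤ (t + t) ^ K := pow_le_pow_left₀ (by positivity) (by linarith) K
      _ = 2 ^ K * t ^ K := by rw [← two_mul, mul_pow]
      _ ≤ 2 ^ K * (1 + t ^ K) := mul_le_mul_of_nonneg_left (le_add_of_nonneg_left zero_le_one) (by positivity)

/-- **Polynomial weights are integrable** under a finite measure all of whose per-site moments of order
`K` are finite: `(1 + ‖x‖)^K ∈ L¹(μ)`. [folklore] -/
theorem integrable_one_add_norm_pow (μ : Measure (PhaseSpace N)) [IsFiniteMeasure μ] (K : ℕ)
    (hmom : ∀ i : Fin N, Integrable (fun x : PhaseSpace N => |x.1 i| ^ K + |x.2 i| ^ K) μ) :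
    Integrable (fun x : PhaseSpace N => (1 + ‖x‖) ^ K) μ := by
  have hmeas : AEStronglyMeasurable (fun x : PhaseSpace N => (1 + ‖x‖) ^ K) μ :=
    ((continuous_const.add continuous_norm).pow K).aestronglyMeasurable
  rcases Nat.eq_zero_or_pos N with hN | hN
  · subst hN
    refine (integrable_const ((2 : ℝ) ^ K * (1 + 0 ^ K) + 1)).mono' hmeas (Eventually.of_forall fun x => ?_)
    have hx : ‖x‖ = 0 := by
      rw [Prod.norm_def]
      simp [Subsingleton.elim x.1 0, Subsingleton.elim x.2 0]
    rw [Real.norm_eq_abs, abs_of_nonneg (by positivity), hx]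
    have := one_add_pow_le_two_pow_mul (le_refl (0:ℝ)) K
    linarith
  · have hsum : Integrable (fun x : PhaseSpace N => (2 : ℝ) ^ K * (1 + ∑ i : Fin N, (|x.1 i| ^ K + |x.2 i| ^ K))) μ :=
      ((integrable_const 1).add (integrable_finsetSum _ fun i _ => hmom i)).const_mul _
    refine hsum.mono' hmeas (Eventually.of_forall fun x => ?_)
    rw [Real.norm_eq_abs, abs_of_nonneg (by positivity)]
    calc (1 + ‖x‖) ^ K ≤ 2 ^ K * (1 + ‖x‖ ^ K) := one_add_pow_le_two_pow_mul (norm_nonneg _) K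
      _ ≤ 2 ^ K * (1 + ∑ i : Fin N, (|x.1 i| ^ K + |x.2 i| ^ K)) := by
          gcongr
          exact norm_pow_le_sum_abs_pow hN x K

/-- Monotonicity of the weights in the exponent: `(1 + ‖x‖)^a ≤ (1 + ‖x‖)^b` for `a ≤ b`. [folklore] -/
theorem one_add_norm_pow_mono (x : PhaseSpace N) {a b : ℕ} (hab : a ≤ b) :
    (1 + ‖x‖) ^ a ≤ (1 + ‖x‖) ^ b :=
  pow_le_pow_right₀ (le_add_of_nonneg_right (norm_nonneg _)) hab

/-! ### Polynomial bound on the forces of the pinned chain, arbitrary parameters -/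

/-- `|q_j - q_i| ≤ 2‖x‖`. [folklore] -/
theorem abs_sub_coord_le (x : PhaseSpace N) (i j : Fin N) : |x.1 j - x.1 i| ≤ 2 * ‖x‖ := by
  have hi := (abs_coord_le_norm x i).1
  have hj := (abs_coord_le_norm x j).1
  calc |x.1 j - x.1 i| ≤ |x.1 j| + |x.1 i| := abs_sub _ _
    _ ≤ 2 * ‖x‖ := by linarith

/-- `|r + β r³| ≤ (2 + 8|β|)(1 + ‖x‖)³` for `|r| ≤ 2‖x‖`. [folklore] -/
theorem abs_deriv_V_bound {r s β : ℝ} (hs : 0 ≤ s) (hr : |r| ≤ 2 * s) :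
    |r + β * r ^ 3| ≤ (2 + 8 * |β|) * (1 + s) ^ 3 := by
  have h1 : (1:ℝ) ≤ (1 + s) := by linarith
  have hs3 : s ≤ (1 + s) ^ 3 := by
    have e : (1 + s) ^ 3 = 1 + 3 * s + 3 * s ^ 2 + s ^ 3 := by ring
    rw [e]; nlinarith [sq_nonneg s, pow_nonneg hs 3]
  have hr3 : |r| ^ 3 ≤ 8 * (1 + s) ^ 3 := by
    calc |r| ^ 3 ≤ (2 * s) ^ 3 := pow_le_pow_left₀ (abs_nonneg _) hr 3
      _ = 8 * s ^ 3 := by ring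
      _ ≤ 8 * (1 + s) ^ 3 := by gcongr; linarith
  calc |r + β * r ^ 3| ≤ |r| + |β| * |r| ^ 3 := by
        refine (abs_add_le _ _).trans (add_le_add le_rfl ?_)
        rw [abs_mul, abs_pow]
    _ ≤ 2 * (1 + s) ^ 3 + |β| * (8 * (1 + s) ^ 3) := by
        refine add_le_add (by linarith) (mul_le_mul_of_nonneg_left hr3 (abs_nonneg _))
    _ = (2 + 8 * |β|) * (1 + s) ^ 3 := by ring

/-- **Polynomial force bound for the pinned chain, any real parameters**:
`|∂_{q_i} H(x)| ≤ (|ω₂| + |lam| + 4 + 16|β|) (1 + ‖x‖)³`. [folklore] -/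
theorem pinnedChain_abs_partialQ_hamiltonian_le (ω₂ lam β γ : ℝ) (x : PhaseSpace N) (i : Fin N) :
    |partialQ i ((pinnedChain ω₂ lam β γ).hamiltonian N) x| ≤
      (|ω₂| + |lam| + 4 + 16 * |β|) * (1 + ‖x‖) ^ 3 := by
  set P := pinnedChain ω₂ lam β γ with hP
  have hU : Differentiable ℝ P.U := (pinnedChain_contDiff_U ω₂ lam β γ (n := 1)).differentiable one_ne_zero
  have hV : Differentiable ℝ P.V := (pinnedChain_contDiff_V ω₂ lam β γ (n := 1)).differentiable one_ne_zero
  rw [P.partialQ_hamiltonian_eq_dPotential hU hV, P.dPotential_eq_closed]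
  set s := ‖x‖ with hs
  have hs0 : 0 ≤ s := norm_nonneg _
  have h1 : (1:ℝ) ≤ 1 + s := by linarith
  have hs3 : s ≤ (1 + s) ^ 3 := by
    have e : (1 + s) ^ 3 = 1 + 3 * s + 3 * s ^ 2 + s ^ 3 := by ring
    rw [e]; nlinarith [sq_nonneg s, pow_nonneg hs0 3]
  have hq : |x.1 i| ≤ s := (abs_coord_le_norm x i).1
  -- pinning term
  have hUb : |deriv P.U (x.1 i)| ≤ (|ω₂| + |lam|) * (1 + s) ^ 3 := by
    rw [hP, pinnedChain_deriv_U]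
    have hq1 : |x.1 i| ≤ (1 + s) ^ 3 := hq.trans hs3
    have hq3 : |x.1 i| ^ 3 ≤ (1 + s) ^ 3 := pow_le_pow_left₀ (abs_nonneg _) (by linarith) 3
    calc |ω₂ * x.1 i + lam * x.1 i ^ 3| ≤ |ω₂| * |x.1 i| + |lam| * |x.1 i| ^ 3 := by
          refine (abs_add_le _ _).trans ?_
          rw [abs_mul, abs_mul, abs_pow]
      _ ≤ |ω₂| * (1 + s) ^ 3 + |lam| * (1 + s) ^ 3 :=
          add_le_add (mul_le_mul_of_nonneg_left hq1 (abs_nonneg _)) (mul_le_mul_of_nonneg_left hq3 (abs_nonneg _))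
      _ = (|ω₂| + |lam|) * (1 + s) ^ 3 := by ring
  -- interaction terms
  have hVb : ∀ a b : Fin N, |deriv P.V (x.1 a - x.1 b)| ≤ (2 + 8 * |β|) * (1 + s) ^ 3 := by
    intro a b
    rw [hP, pinnedChain_deriv_V]
    exact abs_deriv_V_bound hs0 (abs_sub_coord_le x b a)
  have hL : |(if h : 0 < i.val then deriv P.V (x.1 i - x.1 ⟨i.val - 1, by omega⟩) else 0)| ≤
      (2 + 8 * |β|) * (1 + s) ^ 3 := by
    split_ifs
    · exact hVb _ _
    · rw [abs_zero]; positivity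
  have hR : |(if h : i.val + 1 < N then deriv P.V (x.1 ⟨i.val + 1, h⟩ - x.1 i) else 0)| ≤
      (2 + 8 * |β|) * (1 + s) ^ 3 := by
    split_ifs
    · exact hVb _ _
    · rw [abs_zero]; positivity
  calc _ ≤ |deriv P.U (x.1 i) + (if h : 0 < i.val then deriv P.V (x.1 i - x.1 ⟨i.val - 1, by omega⟩) else 0)| +
        |(if h : i.val + 1 < N then deriv P.V (x.1 ⟨i.val + 1, h⟩ - x.1 i) else 0)| := abs_sub _ _
    _ ≤ (|deriv P.U (x.1 i)| + |(if h : 0 < i.val then deriv P.V (x.1 i - x.1 ⟨i.val - 1, by omega⟩) else 0)|) +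
        |(if h : i.val + 1 < N then deriv P.V (x.1 ⟨i.val + 1, h⟩ - x.1 i) else 0)| :=
        add_le_add (abs_add_le _ _) le_rfl
    _ ≤ ((|ω₂| + |lam|) * (1 + s) ^ 3 + (2 + 8 * |β|) * (1 + s) ^ 3) + (2 + 8 * |β|) * (1 + s) ^ 3 :=
        add_le_add (add_le_add hUb hL) hR
    _ = (|ω₂| + |lam| + 4 + 16 * |β|) * (1 + s) ^ 3 := by ring

/-! ### Weak stationarity for polynomially bounded observables -/

/-- **Weak stationarity on polynomially bounded bulk observables, any real parameters.**
Let `P` have smooth potentials and polynomially bounded forces (`|∂_{q_i}H| ≤ C_H (1 + ‖x‖)^{K_H}`),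
`μ` a finite measure on the `N`-chain phase space with `∫ L g dμ = 0` for all `g ∈ C_c^∞` and
`(1 + ‖x‖)^K ∈ L¹(μ)` for all `K`. Then every smooth `w` which does not depend on the bath momenta
(`∂_{p_0} w = ∂_{p_{N-1}} w = 0`) and has `|w|, |Lw| ≤ C (1 + ‖x‖)^K` satisfies `∫ L w dμ = 0`.
Proof: test on `w χ(H₀/(n+1))`; no carré-du-champ term; `|L(wχ_n)| ≤ const (1 + ‖x‖)^{K + K_H + 2}`
uniformly in `n`; dominated convergence. [folklore] -/
theorem integral_generator_eq_zero_of_polyGrowth (P : OscillatorChain) (hU : ContDiff ℝ ∞ P.U)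
    (hV : ContDiff ℝ ∞ P.V) (T_L T_R : ℝ) {C_H : ℝ} {K_H : ℕ}
    (hH : ∀ (i : Fin N) (x : PhaseSpace N), |partialQ i (P.hamiltonian N) x| ≤ C_H * (1 + ‖x‖) ^ K_H)
    (μ : Measure (PhaseSpace N)) [IsFiniteMeasure μ]
    (hweak : ∀ g : PhaseSpace N → ℝ, ContDiff ℝ ∞ g → HasCompactSupport g →
      ∫ x, P.generator N T_L T_R g x ∂μ = 0)
    (hmom : ∀ K : ℕ, Integrable (fun x : PhaseSpace N => (1 + ‖x‖) ^ K) μ)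
    {w : PhaseSpace N → ℝ} (hw : ContDiff ℝ ∞ w)
    (h0 : ∀ i : Fin N, i.val = 0 → ∀ x, partialP i w x = 0)
    (h1 : ∀ i : Fin N, i.val = N - 1 → ∀ x, partialP i w x = 0)
    {C : ℝ} {K : ℕ} (hwb : ∀ x, |w x| ≤ C * (1 + ‖x‖) ^ K)
    (hLw : ∀ x, |P.generator N T_L T_R w x| ≤ C * (1 + ‖x‖) ^ K) :
    ∫ x, P.generator N T_L T_R w x ∂μ = 0 := by
  set H₀ : PhaseSpace N → ℝ := (⟨fun q => q ^ 2 / 2, fun _ => 0, 0⟩ : OscillatorChain).hamiltonian N with hH₀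
  have hU1 : ContDiff ℝ 1 P.U := hU.of_le (by norm_cast)
  have hV1 : ContDiff ℝ 1 P.V := hV.of_le (by norm_cast)
  have hw2 : ContDiff ℝ 2 w := hw.of_le (by norm_cast)
  obtain ⟨M₁, hM₁0, hM₁⟩ := exists_bound_deriv_smoothCutoff
  obtain ⟨M₂, hM₂0, hM₂⟩ := exists_bound_deriv_deriv_smoothCutoff
  -- nonnegative versions of the constants
  set C' : ℝ := max C 0 with hC'
  set C_H' : ℝ := max C_H 0 with hC_H'
  have hC'0 : 0 ≤ C' := le_max_right _ _
  have hC_H'0 : 0 ≤ C_H' := le_max_right _ _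
  have hwb' : ∀ x, |w x| ≤ C' * (1 + ‖x‖) ^ K := fun x =>
    (hwb x).trans (mul_le_mul_of_nonneg_right (le_max_left _ _) (by positivity))
  have hLw' : ∀ x, |P.generator N T_L T_R w x| ≤ C' * (1 + ‖x‖) ^ K := fun x =>
    (hLw x).trans (mul_le_mul_of_nonneg_right (le_max_left _ _) (by positivity))
  have hH' : ∀ (i : Fin N) (x : PhaseSpace N), |partialQ i (P.hamiltonian N) x| ≤ C_H' * (1 + ‖x‖) ^ K_H :=
    fun i x => (hH i x).trans (mul_le_mul_of_nonneg_right (le_max_left _ _) (by positivity))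
  -- the test functions `w χ(H₀/(n+1))`
  set θ : ℕ → PhaseSpace N → ℝ := fun n y => smoothCutoff (H₀ y / ((n : ℝ) + 1)) with hθ
  have hθs : ∀ n, ContDiff ℝ ∞ (θ n) := fun n => contDiff_refCutoff _
  have hθ2 : ∀ n, ContDiff ℝ 2 (θ n) := fun n => contDiff_refCutoff _
  have hgs : ∀ n, ContDiff ℝ ∞ (w * θ n) := fun n => hw.mul (hθs n)
  have hgc : ∀ n, HasCompactSupport (w * θ n) := fun n =>
    hasCompactSupport_mul_refCutoff (by positivity) w
  have hweak_n : ∀ n, ∫ x, P.generator N T_L T_R (w * θ n) x ∂μ = 0 := fun n => hweak _ (hgs n) (hgc n)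
  have hprod : ∀ n x, P.generator N T_L T_R (w * θ n) x =
      w x * P.generator N T_L T_R (θ n) x + θ n x * P.generator N T_L T_R w x := fun n x =>
    generator_mul_of_partialP_bath_eq_zero P T_L T_R hw2 (hθ2 n) h0 h1 x
  -- the dominating function
  set A : ℝ := M₁ * N * (1 + C_H') + |P.γ| * ((|T_L| + |T_R|) * (M₂ + M₁) + 2 * M₁) with hA
  have hA0 : 0 ≤ A := by positivity
  set Bnd : PhaseSpace N → ℝ := fun x => C' * (A + 1) * (1 + ‖x‖) ^ (K + (K_H + 2)) with hBnd
  have hBndi : Integrable Bnd μ := (hmom (K + (K_H + 2))).const_mul _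
  -- the bound on `Lχ_n`, uniformly in `n`
  have hQ : ∀ x : PhaseSpace N,
      M₁ * ∑ i : Fin N, (|x.2 i| * |x.1 i| + |partialQ i (P.hamiltonian N) x| * |x.2 i|) +
        |P.γ| * ((|T_L| + |T_R|) * (M₂ * ‖x‖ ^ 2 + M₁) + 2 * M₁ * ‖x‖ ^ 2) ≤
      A * (1 + ‖x‖) ^ (K_H + 2) := by
    intro x
    set t : ℝ := 1 + ‖x‖ with ht
    have hs0 : 0 ≤ ‖x‖ := norm_nonneg _
    have ht1 : 1 ≤ t := by rw [ht]; linarith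
    have ht0 : 0 ≤ t := by linarith
    have hst : ‖x‖ ≤ t := by linarith
    have htK : t ^ 2 ≤ t ^ (K_H + 2) := pow_le_pow_right₀ ht1 (by omega)
    have htK1 : t ^ (K_H + 1) ≤ t ^ (K_H + 2) := pow_le_pow_right₀ ht1 (by omega)
    have h1t : (1:ℝ) ≤ t ^ 2 := one_le_pow₀ ht1
    have hterm : ∀ i : Fin N, |x.2 i| * |x.1 i| + |partialQ i (P.hamiltonian N) x| * |x.2 i| ≤
        (1 + C_H') * t ^ (K_H + 2) := by
      intro i
      have hq := (abs_coord_le_norm x i).1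
      have hp := (abs_coord_le_norm x i).2
      have e1 : |x.2 i| * |x.1 i| ≤ t ^ (K_H + 2) := by
        calc |x.2 i| * |x.1 i| ≤ t * t := mul_le_mul (hp.trans hst) (hq.trans hst) (abs_nonneg _) ht0
          _ = t ^ 2 := by ring
          _ ≤ t ^ (K_H + 2) := htK
      have e2 : |partialQ i (P.hamiltonian N) x| * |x.2 i| ≤ C_H' * t ^ (K_H + 2) := by
        calc |partialQ i (P.hamiltonian N) x| * |x.2 i| ≤ C_H' * t ^ K_H * t :=
              mul_le_mul (hH' i x) (hp.trans hst) (abs_nonneg _) (by positivity)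
          _ = C_H' * t ^ (K_H + 1) := by ring
          _ ≤ C_H' * t ^ (K_H + 2) := mul_le_mul_of_nonneg_left htK1 hC_H'0
      calc _ ≤ t ^ (K_H + 2) + C_H' * t ^ (K_H + 2) := add_le_add e1 e2
        _ = (1 + C_H') * t ^ (K_H + 2) := by ring
    have hsum : ∑ i : Fin N, (|x.2 i| * |x.1 i| + |partialQ i (P.hamiltonian N) x| * |x.2 i|) ≤
        N * ((1 + C_H') * t ^ (K_H + 2)) := by
      calc _ ≤ ∑ _i : Fin N, (1 + C_H') * t ^ (K_H + 2) := Finset.sum_le_sum fun i _ => hterm i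
        _ = N * ((1 + C_H') * t ^ (K_H + 2)) := by simp
    have hbath : (|T_L| + |T_R|) * (M₂ * ‖x‖ ^ 2 + M₁) + 2 * M₁ * ‖x‖ ^ 2 ≤
        ((|T_L| + |T_R|) * (M₂ + M₁) + 2 * M₁) * t ^ (K_H + 2) := by
      have hs2 : ‖x‖ ^ 2 ≤ t ^ (K_H + 2) := (pow_le_pow_left₀ hs0 hst 2).trans htK
      have e1 : M₂ * ‖x‖ ^ 2 + M₁ ≤ (M₂ + M₁) * t ^ (K_H + 2) := by
        have : M₁ ≤ M₁ * t ^ (K_H + 2) := le_mul_of_one_le_right hM₁0 (h1t.trans htK)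
        nlinarith [mul_le_mul_of_nonneg_left hs2 hM₂0]
      have e2 : 2 * M₁ * ‖x‖ ^ 2 ≤ 2 * M₁ * t ^ (K_H + 2) := mul_le_mul_of_nonneg_left hs2 (by positivity)
      have hT : 0 ≤ |T_L| + |T_R| := by positivity
      nlinarith [mul_le_mul_of_nonneg_left e1 hT]
    calc _ ≤ M₁ * (N * ((1 + C_H') * t ^ (K_H + 2))) +
          |P.γ| * (((|T_L| + |T_R|) * (M₂ + M₁) + 2 * M₁) * t ^ (K_H + 2)) :=
          add_le_add (mul_le_mul_of_nonneg_left hsum hM₁0) (mul_le_mul_of_nonneg_left hbath (abs_nonneg _))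
      _ = A * t ^ (K_H + 2) := by rw [hA]; ring
  -- the uniform bound on `L(w χ_n)`
  have hbound : ∀ (n : ℕ) (x : PhaseSpace N), |P.generator N T_L T_R (w * θ n) x| ≤ Bnd x := by
    intro n x
    rw [hprod n x]
    have hR1 : (1:ℝ) ≤ (n : ℝ) + 1 := by
      have : (0:ℝ) ≤ n := Nat.cast_nonneg n
      linarith
    have hLθ : |P.generator N T_L T_R (θ n) x| ≤ A * (1 + ‖x‖) ^ (K_H + 2) :=
      (abs_generator_refCutoff_le P T_L T_R hM₁0 hM₁ hM₂0 hM₂ hR1 x).trans (hQ x)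
    have hθ1 : |θ n x| ≤ 1 := abs_refCutoff_le_one _ _
    have hpow : (1 + ‖x‖) ^ K * (1 + ‖x‖) ^ (K_H + 2) = (1 + ‖x‖) ^ (K + (K_H + 2)) := by rw [← pow_add]
    have hmonoK : (1 + ‖x‖) ^ K ≤ (1 + ‖x‖) ^ (K + (K_H + 2)) := one_add_norm_pow_mono x (by omega)
    have e1 : |w x * P.generator N T_L T_R (θ n) x| ≤ C' * A * (1 + ‖x‖) ^ (K + (K_H + 2)) := by
      rw [abs_mul]
      calc |w x| * |P.generator N T_L T_R (θ n) x| ≤ (C' * (1 + ‖x‖) ^ K) * (A * (1 + ‖x‖) ^ (K_H + 2)) :=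
            mul_le_mul (hwb' x) hLθ (abs_nonneg _) (by positivity)
        _ = C' * A * (1 + ‖x‖) ^ (K + (K_H + 2)) := by rw [← hpow]; ring
    have e2 : |θ n x * P.generator N T_L T_R w x| ≤ C' * (1 + ‖x‖) ^ (K + (K_H + 2)) := by
      rw [abs_mul]
      calc |θ n x| * |P.generator N T_L T_R w x| ≤ 1 * (C' * (1 + ‖x‖) ^ K) :=
            mul_le_mul hθ1 (hLw' x) (abs_nonneg _) zero_le_one
        _ ≤ C' * (1 + ‖x‖) ^ (K + (K_H + 2)) := by
            rw [one_mul]; exact mul_le_mul_of_nonneg_left hmonoK hC'0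
    calc _ ≤ _ := abs_add_le _ _
      _ ≤ C' * A * (1 + ‖x‖) ^ (K + (K_H + 2)) + C' * (1 + ‖x‖) ^ (K + (K_H + 2)) := add_le_add e1 e2
      _ = Bnd x := by rw [hBnd]; ring
  -- pointwise convergence (eventually constant)
  have hlim : ∀ x, Tendsto (fun n => P.generator N T_L T_R (w * θ n) x) atTop
      (𝓝 (P.generator N T_L T_R w x)) := by
    intro x
    refine tendsto_const_nhds.congr' ?_
    filter_upwards [eventually_generator_refCutoff_eq_zero P T_L T_R x, eventually_refCutoff_eq_one x]
      with n h0' h1'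
    rw [hprod n x]
    have hθn : θ n x = 1 := h1'
    have hLn : P.generator N T_L T_R (θ n) x = 0 := h0'
    rw [hθn, hLn]
    ring
  -- dominated convergence
  have hmeas : ∀ n, AEStronglyMeasurable (fun x => P.generator N T_L T_R (w * θ n) x) μ := fun n =>
    (P.continuous_generator hU1 hV1 N T_L T_R ((hgs n).of_le (by norm_cast))).aestronglyMeasurable
  have hDCT := tendsto_integral_of_dominated_convergence Bnd hmeas hBndi
    (fun n => Eventually.of_forall fun x => by rw [Real.norm_eq_abs]; exact hbound n x)
    (Eventually.of_forall hlim)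
  simp only [hweak_n] at hDCT
  exact tendsto_nhds_unique hDCT tendsto_const_nhds

end Summit.AtomisticToContinuum.FouriersLaw.Theorems.WindowLimit

end
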